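import Summits.QuantumFields.BalabanUV.T4Continuum.Support.NE7EffectiveFormGradientBound
import Summits.QuantumFields.BalabanUV.T4Continuum.Support.NE7EffectiveFormFlatZeroModes
import Summits.QuantumFields.BalabanUV.T4Continuum.Support.NE7PeriodicDeRhamOneForms
import Summits.QuantumFields.BalabanUV.T4Continuum.Support.NE3LatticeWeitzenbock
import HarnessLib

/-!
# NE7EffectiveFormCurlEquivalence — BAŁABAN'S VARIATIONAL QUADRATIC FORM AT THE FLAT BACKGROUND IS UNIFORMLY EQUIVALENT TO THE COARSE MAXWELL FORM:
# `Σ_P ‖curl_1 ṽ (P)‖²_{HS∕n} ≤ ⟨v, Δ_{j+1} v⟩ ≤ homC 4 · Σ_P ‖curl_1 ṽ (P)‖²_{HS∕n}` for EVERY coarse `v` — EVERY LEVEL `j`, EVERY VOLUME `N`, EVERY `U(n)`, EVERY `L ≥ 2`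

Lineage `b2b-balaban-t4-ne7b-p1` (row NE7b OWNER; junction service for row NE7), generation 160; item (U) of `t4/b2b-balaban-t4-ne7-p1-g116/ROAD-G116.md` §6, homogeneous half, file 5 (the end).
The road's sharp floor ✓ `NE7EffectiveFormCoarseCurlAllLevels.effectiveForm_ge_coarse_curl_flat_allLevels'` (constant ONE) and THIS FILE's ceiling **`effectiveForm_le_curl_flat_allLevels`**:
`D²(minAct_{j+1} ∘ chart_1)(0)[v,v] ≤ homC 4·Σ_{P ∈ perWin 4 N} nhsNormSq (curl_1 ṽ P)` for EVERY `v ∈ skewSub 4 n N` (no gauge condition).  MECHANISM: (§1) the flat LANDAU GAUGE on the torus for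
`𝔲(n)`-valued periodic 1-forms — `∃ ζ` skew `N`-periodic with `ṽ + gaugeDir_1 ζ` coarse-divergence-free (✓ `NE3FlatHodgeSplit.exists_flatHodgeSplit` entrywise, symmetrised by ✓ `skewP`, as in the
road's ✓ `NE7PeriodicDeRhamOneForms`); (§2) the second derivative is a SYMMETRIC (✓ `ContDiffAt.isSymmSndFDerivAt`) POSITIVE (✓ `effectiveForm_eq_zero_of_curlFree_lift`) bilinear form vanishing
on the gauge direction `k = res (gaugeDir_1 ζ)` (✓ `effectiveForm_exact_eq_zero_flat_allLevels`), so `B[v,v] = B[v+k, v+k]` (Cauchy–Schwarz for positive forms, `psd_form_shift_kernel`);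
(§3) ✓ `NE7EffectiveFormGradientBound.effectiveForm_le_grad_flat_allLevels` on the Landau representative, ✓ `NE3LatticeWeitzenbock.weitzenbock_nhs_periodBox_of_flatDiv_eq_zero` (`Σ‖∇η‖² = Σ‖curl η‖²`
for Landau `η`) and gauge invariance of the flat curl.  **`effectiveForm_curl_two_sided_flat_allLevels`**: both sides, one `ε₀`.
HONEST FRAMING: flat datum; quadratic-form bounds for OUR variational `Δ_{j+1}` (B11 (8) minimisers with `sfClass`); `homC 4` is NOT optimised; nothing of Bałaban's asserted
([Balaban1984PropagatorsI] (1.20)–(1.21) context only); NOT NE7 as a spine node; row NE7b NOT touched; spine 0∕9; finite T⁴ rung (B)+1 — NOT infinite volume, NOT mass gap, NOT BetaPertH, NOT Clay.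
-/

set_option autoImplicit false

open scoped BigOperators Matrix Matrix.Norms.L2Operator Topology
open NormedSpace Finset

namespace Summit.QuantumFields.BalabanUV.T4Continuum.NE7EffectiveFormCurlEquivalence

open Literature.MathematicalPhysics.QuantumFieldTheory.Balaban1983to89
open B7Prop1Explicit B7Prop2Explicit
open T4AveragingDeficitWall (curl curlAt IsSkewDir)
open T4AveragingDeficitWallBoundary (periodBox)
open AveragingDeficitPeriodicCounting (IsPeriodicDir)
open AveragingDeficitTorusChart (TDir chart chartDir resDir skewP skewP_mem skewP_of_mem isPeriodicDir_chartDir chartDir_id_resDir)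
open AveragingDeficitTwoLevelPrep (skewSub)
open MinimalActionLevels (perWin)
open MinimalActionSandwich (minAct)
open MinimalActionRate (sfClass)
open MinimalActionWitness (flatCfg isPeriodicCfg_flatCfg)
open MatrixNorms (nhsNormSq nhsNormSq_nonneg)
open BlockAveragePushDirGauge (gaugeDir isPeriodicDir_gaugeDir)
open NE3TangentNoGoWords (dPot)
open NE3TangentFlatPush (gaugeDir_flatCfg)
open NE3FlatHodgeSplit (exists_flatHodgeSplit)
open NE3LatticeWeitzenbock (weitzenbock_nhs_periodBox_of_flatDiv_eq_zero)
open NE7MinActHessianFlatCurl (minAct_hessian_flat_curl)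
open NE7FlatAverageCurlCommutation (curlAt_flatCfg isSkewDir_chartDir_id)
open NE7EffectiveFormCoarseCurlAllLevels (effectiveForm_ge_coarse_curl_flat_allLevels')
open NE7EffectiveFormFlatZeroModes (effectiveForm_eq_zero_of_curlFree_lift effectiveForm_exact_eq_zero_flat_allLevels)
open NE7SmoothRightInverseLevelQ (sum_perWin_nhsNormSq_curl')
open NE7EffectiveFormGradientBound (effectiveForm_le_grad_flat_allLevels)

noncomputable section

variable {d : ℕ} {n : Type} [Fintype n] [DecidableEq n]

/-! ## §1 The flat Landau gauge on the torus for `𝔲(n)`-valued periodic 1-forms -/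

/-- **MATRIX LANDAU GAUGE** (entrywise flat Hodge split): for an `N`-periodic matrix 1-form `Y` there is an `N`-periodic matrix potential `ζ` with `Y − dPot ζ` coarse-divergence-free. [folklore] -/
theorem exists_landau_potential_matrix {N : ℕ} (hN : 1 ≤ N) (Y : Site d → Fin d → Matrix n n ℂ) (hY : IsPeriodicDir Y (N : ℤ)) :
    ∃ ζ : Site d → Matrix n n ℂ, (∀ (x : Site d) (τ : Fin d), ζ (x + (N : ℤ) • e τ) = ζ x) ∧
      ∀ x : Site d, ∑ κ : Fin d, ((Y x κ - dPot ζ x κ) - (Y (x - e κ) κ - dPot ζ (x - e κ) κ)) = 0 := by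
  have hent : ∀ ab : n × n, ∃ ζ : Site d → ℂ, (∀ (x : Site d) (τ : Fin d), ζ (x + (N : ℤ) • e τ) = ζ x) ∧
      ∀ x : Site d, ∑ κ : Fin d, ((Y x κ ab.1 ab.2 - dPot ζ x κ) - (Y (x - e κ) κ ab.1 ab.2 - dPot ζ (x - e κ) κ)) = 0 :=
    fun ab => exists_flatHodgeSplit hN (fun x μ => Y x μ ab.1 ab.2) (fun x τ μ => by rw [hY x τ μ])
  choose ζ hζP hζL using hent
  refine ⟨fun x => Matrix.of fun a b => ζ (a, b) x, fun x τ => ?_, fun x => ?_⟩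
  · ext a b
    simp only [Matrix.of_apply, hζP]
  · ext a b
    have h := hζL (a, b) x
    simp only [Matrix.sum_apply, Matrix.sub_apply, Matrix.zero_apply, dPot, Matrix.of_apply] at h ⊢
    exact h

/-- **`𝔲(n)` LANDAU GAUGE**: for a skew `N`-periodic 1-form `Y` there is a skew `N`-periodic potential `ζ` with `Y + gaugeDir_1 ζ` (`= Y − dPot ζ`) coarse-divergence-free. [folklore] -/
theorem exists_skew_landau_potential {N : ℕ} (hN : 1 ≤ N) (Y : Site d → Fin d → Matrix n n ℂ) (hY : IsPeriodicDir Y (N : ℤ)) (hYs : IsSkewDir Y) :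
    ∃ ζ : Site d → Matrix n n ℂ, (∀ (x : Site d) (τ : Fin d), ζ (x + (N : ℤ) • e τ) = ζ x) ∧ (∀ x : Site d, ζ x ∈ skewAdjoint (Matrix n n ℂ)) ∧
      ∀ x : Site d, ∑ κ : Fin d, ((Y x κ + gaugeDir (flatCfg : Site d → Fin d → (Matrix n n ℂ)ˣ) ζ x κ)
        - (Y (x - e κ) κ + gaugeDir (flatCfg : Site d → Fin d → (Matrix n n ℂ)ˣ) ζ (x - e κ) κ)) = 0 := by
  obtain ⟨ζ', hζ'P, hζ'L⟩ := exists_landau_potential_matrix hN Y hY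
  refine ⟨fun x => skewP (ζ' x), fun x τ => by simp only [hζ'P], fun x => skewP_mem _, fun x => ?_⟩
  -- the divergence of `Y` is skew, the Laplacian term is linear: apply `skewP` to the matrix identity
  have hT : ∑ κ : Fin d, (Y x κ - Y (x - e κ) κ) = ∑ κ : Fin d, (dPot ζ' x κ - dPot ζ' (x - e κ) κ) := by
    have h := hζ'L x
    rw [← sub_eq_zero, ← Finset.sum_sub_distrib]
    rw [← h]
    exact Finset.sum_congr rfl fun κ _ => by abel
  have hskew : skewP (∑ κ : Fin d, (Y x κ - Y (x - e κ) κ)) = ∑ κ : Fin d, (Y x κ - Y (x - e κ) κ) :=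
    skewP_of_mem ((skewAdjoint (Matrix n n ℂ)).sum_mem fun κ _ => (skewAdjoint (Matrix n n ℂ)).sub_mem (hYs _ _) (hYs _ _))
  have hlin : skewP (∑ κ : Fin d, (dPot ζ' x κ - dPot ζ' (x - e κ) κ))
      = ∑ κ : Fin d, (dPot (fun y => skewP (ζ' y)) x κ - dPot (fun y => skewP (ζ' y)) (x - e κ) κ) := by
    rw [map_sum]
    exact Finset.sum_congr rfl fun κ _ => by simp only [dPot, map_sub]
  have key : ∑ κ : Fin d, (Y x κ - Y (x - e κ) κ) = ∑ κ : Fin d, (dPot (fun y => skewP (ζ' y)) x κ - dPot (fun y => skewP (ζ' y)) (x - e κ) κ) := by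
    rw [← hlin, ← hT, hskew]
  simp only [gaugeDir_flatCfg]
  have hrw : ∀ κ : Fin d, (Y x κ + (skewP (ζ' x) - skewP (ζ' (x + e κ)))) - (Y (x - e κ) κ + (skewP (ζ' (x - e κ)) - skewP (ζ' (x - e κ + e κ))))
      = (Y x κ - Y (x - e κ) κ) - (dPot (fun y => skewP (ζ' y)) x κ - dPot (fun y => skewP (ζ' y)) (x - e κ) κ) := by
    intro κ; simp only [dPot]; abel
  rw [Finset.sum_congr rfl fun κ _ => hrw κ, Finset.sum_sub_distrib, key, sub_self]

/-! ## §2 Positive symmetric forms: shifting by a null vector -/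

/-- **CAUCHY–SCHWARZ SHIFT FOR POSITIVE SYMMETRIC FORMS**: if `B` is symmetric, `B[u,u] ≥ 0` for all `u`, and `B[k,k] = 0`, then `B[w + k, w + k] = B[w, w]`. [folklore] -/
theorem psd_form_shift_kernel {E : Type*} [AddCommGroup E] [Module ℝ E] [TopologicalSpace E] (B : E →L[ℝ] E →L[ℝ] ℝ)
    (hsymm : ∀ u w, B u w = B w u) (hpsd : ∀ u, 0 ≤ B u u) {k : E} (hk : B k k = 0) (w : E) : B (w + k) (w + k) = B w w := by
  -- `B[w,k] = 0`: `0 ≤ B[w + t k, w + t k] = B[w,w] + 2 t B[w,k]` for all real `t`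
  have hwk : B w k = 0 := by
    by_contra hne
    have hquad : ∀ t : ℝ, 0 ≤ B w w + 2 * t * B w k := by
      intro t
      have h := hpsd (w + t • k)
      simp only [map_add, map_smul, FunLike.coe_add, FunLike.coe_smul, Pi.add_apply, Pi.smul_apply, smul_eq_mul, hk, mul_zero,
        add_zero, hsymm k w] at h
      nlinarith [h]
    have h := hquad (-(B w w + 1) / (2 * B w k))
    have hid : B w w + 2 * (-(B w w + 1) / (2 * B w k)) * B w k = -1 := by field_simp; ring
    linarith
  simp only [map_add, FunLike.coe_add, Pi.add_apply, hk, hwk, hsymm k w, add_zero]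

/-! ## §3 `d = 4`: the curl-energy upper bound and the two-sided equivalence -/

omit [Fintype n] [DecidableEq n] in
/-- The periodic extension of `v + res g` is `ṽ + g` for `N`-periodic `g`. [folklore] -/
theorem chartDir_add_resDir {N : ℕ} [NeZero N] (v : TDir d n N) {g : Site d → Fin d → Matrix n n ℂ} (hg : IsPeriodicDir g (N : ℤ)) (x : Site d) (κ : Fin d) :
    chartDir (ContinuousLinearMap.id ℝ (Matrix n n ℂ)) N (v + resDir N g) x κ = chartDir (ContinuousLinearMap.id ℝ (Matrix n n ℂ)) N v x κ + g x κ := by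
  have h := congr_fun (congr_fun (chartDir_id_resDir N hg) x) κ
  simp only [chartDir, ContinuousLinearMap.coe_id', id, Pi.add_apply] at h ⊢
  rw [h]

/-- **THE CURL-ENERGY UPPER BOUND** (`d = 4`, every `U(n)`, `L ≥ 2`): for `0 < ε ≤ ε₀`, `N ≥ 1`, EVERY `j`, EVERY `v ∈ skewSub 4 n N` (no gauge condition),
`D²(minAct 4 (sfClass 4 L N ε) L N (j+1) ∘ chart_1)(0)[v,v] ≤ homC 4·Σ_{P ∈ perWin 4 N} nhsNormSq (curl_1 ṽ P)`. [folklore] -/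
theorem effectiveForm_le_curl_flat_allLevels [Nonempty n] {L : ℕ} [NeZero L] (hL : 2 ≤ L) :
    ∃ ε₀ : ℝ, 0 < ε₀ ∧ ∀ ε : ℝ, 0 < ε → ε ≤ ε₀ → ∀ (N : ℕ) [NeZero N], 1 ≤ N → ∀ (j : ℕ) (v : ↥(skewSub 4 n N)),
      fderiv ℝ (fderiv ℝ (fun y : ↥(skewSub 4 n N) => minAct 4 (sfClass 4 L N ε) L N (j + 1)
          (chart (ContinuousLinearMap.id ℝ (Matrix n n ℂ)) N (flatCfg : Site 4 → Fin 4 → (Matrix n n ℂ)ˣ) (y : TDir 4 n N)))) 0 v v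
        ≤ 2 * (2304 * 4 ^ 4 + 4 * (4 : ℝ) * (24 * (8 : ℝ) ^ 3) ^ 2 * ((4 : ℝ) * 2 ^ 16))
          * ∑ P ∈ perWin 4 N, nhsNormSq (curl (flatCfg : Site 4 → Fin 4 → (Matrix n n ℂ)ˣ) (chartDir (ContinuousLinearMap.id ℝ (Matrix n n ℂ)) N (v : TDir 4 n N)) P) := by
  obtain ⟨ε₁, hε₁, H₁⟩ := effectiveForm_le_grad_flat_allLevels (n := n) hL
  obtain ⟨ε₂, hε₂, H₂⟩ := effectiveForm_eq_zero_of_curlFree_lift (n := n) hL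
  obtain ⟨ε₃, hε₃, H₃⟩ := effectiveForm_exact_eq_zero_flat_allLevels (n := n) hL
  obtain ⟨ε₄, hε₄, H₄⟩ := minAct_hessian_flat_curl (n := n) hL
  refine ⟨min (min ε₁ ε₂) (min ε₃ ε₄), lt_min (lt_min hε₁ hε₂) (lt_min hε₃ hε₄), fun ε hε hεle N _ hN j v => ?_⟩
  have hε1 : ε ≤ ε₁ := hεle.trans ((min_le_left _ _).trans (min_le_left _ _))
  have hε2 : ε ≤ ε₂ := hεle.trans ((min_le_left _ _).trans (min_le_right _ _))
  have hε3 : ε ≤ ε₃ := hεle.trans ((min_le_right _ _).trans (min_le_left _ _))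
  have hε4 : ε ≤ ε₄ := hεle.trans ((min_le_right _ _).trans (min_le_right _ _))
  set m : ↥(skewSub 4 n N) → ℝ := fun y => minAct 4 (sfClass 4 L N ε) L N (j + 1)
    (chart (ContinuousLinearMap.id ℝ (Matrix n n ℂ)) N (flatCfg : Site 4 → Fin 4 → (Matrix n n ℂ)ˣ) (y : TDir 4 n N)) with hm
  set B := fderiv ℝ (fderiv ℝ m) 0 with hB
  -- the form: symmetric, positive
  have hC2 : ContDiffAt ℝ 2 m 0 := (H₄ ε hε hε4 N hN j).1
  have hsymm : ∀ u w, B u w = B w u := fun u w => (hC2.isSymmSndFDerivAt (by simp)).eq u w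
  have hpsd : ∀ u : ↥(skewSub 4 n N), 0 ≤ B u u := fun u => (H₂ ε hε hε2 N hN j u).1
  -- the Landau gauge
  set Y := chartDir (ContinuousLinearMap.id ℝ (Matrix n n ℂ)) N (v : TDir 4 n N) with hY
  have hYP : IsPeriodicDir Y (N : ℤ) := isPeriodicDir_chartDir _ N (v : TDir 4 n N)
  have hYs : IsSkewDir Y := isSkewDir_chartDir_id v.2
  obtain ⟨ζ, hζP, hζs, hζL⟩ := exists_skew_landau_potential hN Y hYP hYs
  set g : Site 4 → Fin 4 → Matrix n n ℂ := gaugeDir (flatCfg : Site 4 → Fin 4 → (Matrix n n ℂ)ˣ) ζ with hg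
  have hgP : IsPeriodicDir g (N : ℤ) := isPeriodicDir_gaugeDir (isPeriodicCfg_flatCfg _) hζP
  have hgs : ∀ (r : Fin 4 → Fin N) (κ : Fin 4), resDir N g r κ ∈ skewAdjoint (Matrix n n ℂ) := fun r κ => by
    simp only [resDir, hg, gaugeDir_flatCfg]
    exact (skewAdjoint (Matrix n n ℂ)).sub_mem (hζs _) (hζs _)
  set k : ↥(skewSub 4 n N) := ⟨resDir N g, hgs⟩ with hk
  have hBkk : B k k = 0 := H₃ ε hε hε3 N hN j ζ hζP hζs k rfl
  set w : ↥(skewSub 4 n N) := v + k with hw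
  -- `B[v,v] = B[w,w]`
  have hshift : B v v = B w w := by rw [hw]; exact (psd_form_shift_kernel B hsymm hpsd hBkk v).symm
  -- the Landau representative `η = ṽ + g`
  have hη : ∀ (x : Site 4) (κ : Fin 4), chartDir (ContinuousLinearMap.id ℝ (Matrix n n ℂ)) N (w : TDir 4 n N) x κ = Y x κ + g x κ := fun x κ => by
    rw [hw, Submodule.coe_add]
    exact chartDir_add_resDir (v : TDir 4 n N) hgP x κ
  have hηP : IsPeriodicDir (fun x κ => Y x κ + g x κ) (N : ℤ) := fun x τ κ => by simp only [hYP x τ κ, hgP x τ κ]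
  have hηL : ∀ x : Site 4, ∑ μ : Fin 4, ((Y x μ + g x μ) - (Y (x - e μ) μ + g (x - e μ) μ)) = 0 := hζL
  -- the gradient bound on `w`, Weitzenböck on the Landau slice, gauge invariance of the curl
  have h1 := H₁ ε hε hε1 N hN j w
  simp only [hη] at h1
  rw [weitzenbock_nhs_periodBox_of_flatDiv_eq_zero hN hηP hηL] at h1
  have hcurl : ∀ (x : Site 4) (μ ν : Fin 4), curlAt (flatCfg : Site 4 → Fin 4 → (Matrix n n ℂ)ˣ) (fun x κ => Y x κ + g x κ) x μ ν
      = curlAt (flatCfg : Site 4 → Fin 4 → (Matrix n n ℂ)ˣ) Y x μ ν := by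
    intro x μ ν
    simp only [curlAt_flatCfg, hg, gaugeDir_flatCfg, add_right_comm x (e ν) (e μ)]
    abel
  simp only [hcurl] at h1
  rw [← sum_perWin_nhsNormSq_curl'] at h1
  show B v v ≤ _
  rw [hshift]
  exact h1

/-- **THE UNIFORM EQUIVALENCE WITH THE COARSE MAXWELL FORM** (`d = 4`, every `U(n)`, `L ≥ 2`, `0 < ε ≤ ε₀`, `N ≥ 1`, EVERY `j`, EVERY `v ∈ skewSub 4 n N`):
`Σ_{P ∈ perWin 4 N} nhsNormSq (curl_1 ṽ P) ≤ D²(minAct_{j+1} ∘ chart_1)(0)[v,v] ≤ homC 4·Σ_{P ∈ perWin 4 N} nhsNormSq (curl_1 ṽ P)` — floor ONE (the road's ✓ `effectiveForm_ge_coarse_curl_flat_allLevels'`),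
ceiling `homC 4`; uniform in the level, the volume, the colour number and `L`. [folklore] -/
theorem effectiveForm_curl_two_sided_flat_allLevels [Nonempty n] {L : ℕ} [NeZero L] (hL : 2 ≤ L) :
    ∃ ε₀ : ℝ, 0 < ε₀ ∧ ∀ ε : ℝ, 0 < ε → ε ≤ ε₀ → ∀ (N : ℕ) [NeZero N], 1 ≤ N → ∀ (j : ℕ) (v : ↥(skewSub 4 n N)),
      ∑ P ∈ perWin 4 N, nhsNormSq (curl (flatCfg : Site 4 → Fin 4 → (Matrix n n ℂ)ˣ) (chartDir (ContinuousLinearMap.id ℝ (Matrix n n ℂ)) N (v : TDir 4 n N)) P)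
          ≤ fderiv ℝ (fderiv ℝ (fun y : ↥(skewSub 4 n N) => minAct 4 (sfClass 4 L N ε) L N (j + 1)
              (chart (ContinuousLinearMap.id ℝ (Matrix n n ℂ)) N (flatCfg : Site 4 → Fin 4 → (Matrix n n ℂ)ˣ) (y : TDir 4 n N)))) 0 v v ∧
      fderiv ℝ (fderiv ℝ (fun y : ↥(skewSub 4 n N) => minAct 4 (sfClass 4 L N ε) L N (j + 1)
          (chart (ContinuousLinearMap.id ℝ (Matrix n n ℂ)) N (flatCfg : Site 4 → Fin 4 → (Matrix n n ℂ)ˣ) (y : TDir 4 n N)))) 0 v v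
        ≤ 2 * (2304 * 4 ^ 4 + 4 * (4 : ℝ) * (24 * (8 : ℝ) ^ 3) ^ 2 * ((4 : ℝ) * 2 ^ 16))
          * ∑ P ∈ perWin 4 N, nhsNormSq (curl (flatCfg : Site 4 → Fin 4 → (Matrix n n ℂ)ˣ) (chartDir (ContinuousLinearMap.id ℝ (Matrix n n ℂ)) N (v : TDir 4 n N)) P) := by
  obtain ⟨ε₁, hε₁, H₁⟩ := effectiveForm_ge_coarse_curl_flat_allLevels' (n := n) hL
  obtain ⟨ε₂, hε₂, H₂⟩ := effectiveForm_le_curl_flat_allLevels (n := n) hL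
  refine ⟨min ε₁ ε₂, lt_min hε₁ hε₂, fun ε hε hεle N _ hN j v => ⟨?_, ?_⟩⟩
  · exact H₁ ε hε (hεle.trans (min_le_left _ _)) N hN j v
  · exact H₂ ε hε (hεle.trans (min_le_right _ _)) N hN j v

/-! ## §4 (appended, gen 160) The mixed form: Cauchy–Schwarz in the Maxwell energy seminorm -/

/-- **CAUCHY–SCHWARZ FOR POSITIVE SYMMETRIC FORMS**: `(B[v,w])² ≤ B[v,v]·B[w,w]`. [folklore] -/
theorem psd_form_cauchy_schwarz {E : Type*} [AddCommGroup E] [Module ℝ E] [TopologicalSpace E] (B : E →L[ℝ] E →L[ℝ] ℝ)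
    (hsymm : ∀ u w, B u w = B w u) (hpsd : ∀ u, 0 ≤ B u u) (v w : E) : (B v w) ^ 2 ≤ B v v * B w w := by
  have hquad : ∀ t : ℝ, 0 ≤ B v v + 2 * t * B v w + t ^ 2 * B w w := by
    intro t
    have h := hpsd (v + t • w)
    simp only [map_add, map_smul, FunLike.coe_add, FunLike.coe_smul, Pi.add_apply, Pi.smul_apply, smul_eq_mul, hsymm w v] at h
    nlinarith [h]
  by_cases hww : B w w = 0
  · -- then `B v w = 0` (the quadratic is affine and bounded below)
    have hvw : B v w = 0 := by
      by_contra hne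
      have h := hquad (-(B v v + 1) / (2 * B v w))
      rw [hww, mul_zero, add_zero] at h
      have hid : B v v + 2 * (-(B v v + 1) / (2 * B v w)) * B v w = -1 := by field_simp; ring
      linarith
    rw [hvw, hww]; simp
  · have hpos : 0 < B w w := lt_of_le_of_ne (hpsd w) (Ne.symm hww)
    have h := hquad (-(B v w) / B w w)
    have hid : B v v + 2 * (-(B v w) / B w w) * B v w + (-(B v w) / B w w) ^ 2 * B w w = B v v - (B v w) ^ 2 / B w w := by
      field_simp; ring
    rw [hid, sub_nonneg, div_le_iff₀ hpos] at h
    linarith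

/-- **THE MIXED EFFECTIVE FORM IS BOUNDED IN THE COARSE MAXWELL ENERGY SEMINORM** (`d = 4`, every `U(n)`, `L ≥ 2`, `0 < ε ≤ ε₀`, `N ≥ 1`, EVERY `j`, every `v, w ∈ skewSub 4 n N`):
`(D²m_{j+1}(0)[v,w])² ≤ (homC 4)²·(Σ_P nhsNormSq (curl_1 ṽ P))·(Σ_P nhsNormSq (curl_1 w̃ P))`. [folklore] -/
theorem effectiveForm_mixed_sq_le_curl_flat_allLevels [Nonempty n] {L : ℕ} [NeZero L] (hL : 2 ≤ L) :
    ∃ ε₀ : ℝ, 0 < ε₀ ∧ ∀ ε : ℝ, 0 < ε → ε ≤ ε₀ → ∀ (N : ℕ) [NeZero N], 1 ≤ N → ∀ (j : ℕ) (v w : ↥(skewSub 4 n N)),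
      (fderiv ℝ (fderiv ℝ (fun y : ↥(skewSub 4 n N) => minAct 4 (sfClass 4 L N ε) L N (j + 1)
          (chart (ContinuousLinearMap.id ℝ (Matrix n n ℂ)) N (flatCfg : Site 4 → Fin 4 → (Matrix n n ℂ)ˣ) (y : TDir 4 n N)))) 0 v w) ^ 2
        ≤ (2 * (2304 * 4 ^ 4 + 4 * (4 : ℝ) * (24 * (8 : ℝ) ^ 3) ^ 2 * ((4 : ℝ) * 2 ^ 16))) ^ 2
          * (∑ P ∈ perWin 4 N, nhsNormSq (curl (flatCfg : Site 4 → Fin 4 → (Matrix n n ℂ)ˣ) (chartDir (ContinuousLinearMap.id ℝ (Matrix n n ℂ)) N (v : TDir 4 n N)) P))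
          * (∑ P ∈ perWin 4 N, nhsNormSq (curl (flatCfg : Site 4 → Fin 4 → (Matrix n n ℂ)ˣ) (chartDir (ContinuousLinearMap.id ℝ (Matrix n n ℂ)) N (w : TDir 4 n N)) P)) := by
  obtain ⟨ε₁, hε₁, H₁⟩ := effectiveForm_le_curl_flat_allLevels (n := n) hL
  obtain ⟨ε₂, hε₂, H₂⟩ := effectiveForm_eq_zero_of_curlFree_lift (n := n) hL
  obtain ⟨ε₄, hε₄, H₄⟩ := minAct_hessian_flat_curl (n := n) hL
  refine ⟨min ε₁ (min ε₂ ε₄), lt_min hε₁ (lt_min hε₂ hε₄), fun ε hε hεle N _ hN j v w => ?_⟩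
  have hε1 : ε ≤ ε₁ := hεle.trans (min_le_left _ _)
  have hε2 : ε ≤ ε₂ := hεle.trans ((min_le_right _ _).trans (min_le_left _ _))
  have hε4 : ε ≤ ε₄ := hεle.trans ((min_le_right _ _).trans (min_le_right _ _))
  set m : ↥(skewSub 4 n N) → ℝ := fun y => minAct 4 (sfClass 4 L N ε) L N (j + 1)
    (chart (ContinuousLinearMap.id ℝ (Matrix n n ℂ)) N (flatCfg : Site 4 → Fin 4 → (Matrix n n ℂ)ˣ) (y : TDir 4 n N)) with hm
  set B := fderiv ℝ (fderiv ℝ m) 0 with hB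
  have hC2 : ContDiffAt ℝ 2 m 0 := (H₄ ε hε hε4 N hN j).1
  have hsymm : ∀ u u', B u u' = B u' u := fun u u' => (hC2.isSymmSndFDerivAt (by simp)).eq u u'
  have hpsd : ∀ u : ↥(skewSub 4 n N), 0 ≤ B u u := fun u => (H₂ ε hε hε2 N hN j u).1
  have hcs := psd_form_cauchy_schwarz B hsymm hpsd v w
  have hv := H₁ ε hε hε1 N hN j v
  have hw := H₁ ε hε hε1 N hN j w
  have hC0 : (0 : ℝ) ≤ 2 * (2304 * 4 ^ 4 + 4 * (4 : ℝ) * (24 * (8 : ℝ) ^ 3) ^ 2 * ((4 : ℝ) * 2 ^ 16)) := by positivity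
  have hSv : 0 ≤ ∑ P ∈ perWin 4 N, nhsNormSq (curl (flatCfg : Site 4 → Fin 4 → (Matrix n n ℂ)ˣ) (chartDir (ContinuousLinearMap.id ℝ (Matrix n n ℂ)) N (v : TDir 4 n N)) P) :=
    Finset.sum_nonneg fun P _ => nhsNormSq_nonneg _
  have hSw : 0 ≤ ∑ P ∈ perWin 4 N, nhsNormSq (curl (flatCfg : Site 4 → Fin 4 → (Matrix n n ℂ)ˣ) (chartDir (ContinuousLinearMap.id ℝ (Matrix n n ℂ)) N (w : TDir 4 n N)) P) :=
    Finset.sum_nonneg fun P _ => nhsNormSq_nonneg _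
  show (B v w) ^ 2 ≤ _
  calc (B v w) ^ 2 ≤ B v v * B w w := hcs
    _ ≤ _ := by
        have := mul_le_mul hv hw (hpsd w) (mul_nonneg hC0 hSv)
        linarith [this]

end

end Summit.QuantumFields.BalabanUV.T4Continuum.NE7EffectiveFormCurlEquivalence
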